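import Summits.QuantumFields.YangMills.Theorems.BalabanUVNodesN07Thm4RecordStructureDbar
import Literature.MathematicalPhysics.QuantumFieldTheory.Balaban1983to89.Node00.TorusCoverLandau153RecDatumDoorOfCrown
import Literature.MathematicalPhysics.QuantumFieldTheory.Balaban1983to89.Node00.TorusCoverCollarOfMeetsPrintBox
import HarnessLib

/-!
# N07 [B11] (= [15] = [Balaban1985Variational]) Sect. F — **THE KNIT OF THE R7 DOOR INTO THE PREMISE OF RECORD, MODULO R6 AT THE DATUM**:
# `HThm4RecMember` (= dag-n07-e's `HThm4RecDbar` with its NINTH row, `NrmDbarWideOfRecord`, replaced by the door's MEMBER ROWS for the same `(u, A)`) ⟸ `DatumCrownAt`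
# (= [6] Proposition 6's conclusion FOR THE RECORD STRUCTURE at the print datum `propCubePZ`, the R6 crown specialised — a displayed premise, NEVER asserted)

Cell `pub-ymgap`, width seat `pub-ymgap-dag-n07-w3` g11 (N05-REC R7 → THE KNIT; LEAD PEN of N05-REC = dag-n05-e; text of record = dag-n07-e MODULE 88″ `…N07Thm4RecordStructureDbar`).
`--kind definition --supports stmt-QuantumFields-20542 --as helper` (K1⁷; count-neutral).  TWO `def`s (displayed premise ∕ displayed conclusion shape) + theorems.
[6] = [Balaban1985RegularSpaces]; [15] = [Balaban1985Variational]; [III] = [Balaban1988Convergent]; [I] = [Balaban1987RG1].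

WHY.  g10's HANDOFF § KNIT OBLIGATIONS: the premise of record `HThm4RecDbar F N Mc ρ κ a₀` (MODULE 88″ :80–111) asks, per separated run, tolerance profile `ε ≤ a₀`, field `U`
in the (1.7)∕(1.9) class on the record regions, level `1 ≤ j ≤ k` and grid datum `idx` whose print box meets `Ω_j` within `3`, for a torus gauge `u` and a potential `A` with
NINE rows.  This lineage's R7 door `Node00.exists_datumGauge152_153_member_of_crownAt` (g10 FILE-11) delivers rows 1–8 in that currency FROM (a) the R6 crown at the datum,
(b) the collar «π(□̃) ⊆ Ω_{j−1}» ∕ «⊆ Ω₀» at `j = 1`, (c) the non-wrapping of `□̃`, (d) two windows on `ε_{j−1}`.  THIS FILE discharges (b) from the meeting witness (dag-n07-e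
`Sect2.cover_image_Ω_cubeIdxP'_subset_of_within_mem_box`, `Node00.cover_mem_hullD_one_of_within`; `suppDomOfRecord = hullD … M₁ 1 (Ω 1)`), (c) from the no-wrap guard
`Mc + 44 + 6ρ ≤ sitesPerDir k` (g10 `injOn_cover_tcube_of_guard`, `sitesPerDir` antitone), (d) from `ε_{j−1} ≤ a₀` with `L³·a₀ ≤ α₁` and `4·N·Cr·L³·a₀ < 2π`, and turns the
door's `≤ 2·r·Lⁱ`-letters (`r = Cr·L³·ε_{j−1} ≤ 2·Cr·L³·ε_j`, `i ≤ 3`, `η_j = L^{−j}`) into the STRICT rows `< κ·ε_j·(…)` for every `κ > 4·Cr·L⁶` — leaving EXACTLY ONE displayed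
premise, `DatumCrownAt F N Mc ρ hρ Cr α₁` = FILE-11's `hP6` quantified over the knit's data (R6's conclusion at `c := propCubePZ …`, `G := SU(N)`, one tolerance `α ≤ α₁`).
The ninth row of `HThm4RecDbar` (`NrmDbarWideOfRecord … u A`, dag-n07-e MODULE 91″) is NOT a door output; `HThm4RecMember` carries instead the door's MEMBER ROWS (iv′) `A` on
`□̃ᶻ` is the (1.135)-exponent of the member configuration, (v) `u ∘ π = um⁻¹·v` on `□₀ᶻ`, (vi) `um ∈ SU(N)`, `um = 1` off `□₀ᶻ`, (1.29) «ū_m = 1 on Λ′_j» (`Restr129Z`), (vii) the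
(1.137) identity — the input of the (e)-step `HThm4RecMember → HThm4RecDbar` (dag-n07-e's lane; NOT typed here).

WHAT IS DECLARED ∕ PROVED (kernel; `d = 4`; axioms standard).
* §1 `DatumCrownAt F N Mc ρ hρ Cr α₁ : Prop` — displayed premise (a), NEVER asserted.
* §2 `HThm4RecMember F N Mc ρ hρ κ a₀ : Prop` — `HThm4RecDbar`'s binders and rows 1–8 BYTE FOR BYTE (the binder `1 ≤ j` named), row 9 ↦ `∃ um, (iv′) ∧ (v) ∧ (vi) ∧ (vii)`.
* §2b `hThm4RecMember_mono` (`κ` up, `a₀` down).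
* §3 ★★★ `hThm4RecMember_of_datumCrownAt (hρ : F.L ≤ ρ) (hCr : 0 ≤ Cr) (hcrown : DatumCrownAt …) (hκ : 4·Cr·L⁶ < κ) (hα : L³·a₀ ≤ α₁) (hwin : 4·N·Cr·L³·a₀ < 2π) :
  HThm4RecMember F N Mc ρ hρ κ a₀`; §0 three arithmetic ∕ bookkeeping lemmas (`sitesPerDir` antitone, `(L^{j′}·η_j)⁻¹ = L^{j−j′}`, the strict-row budget).
HONEST FRAMING: count-neutral composition by name; R6's crown is a displayed HYPOTHESIS; the `Nrm` row (e) is NOT produced; `HThm4RecDbar` ∕ `HThm4Rec` UNDISCHARGED (caveat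
(C-S3-1)); N05 ∕ N07 NOT discharged; K0⁷ ∕ K1⁹ NOT closed; counts unmoved (typed 28∕28 · discharged 8∕27); one finite 𝕋⁴ programme at fixed ε — R4 closes the conditional
finite-𝕋⁴ rung `BalabanLadder.UV` ONLY; the YM mass gap (Clay) is NOT proved by any of this; nothing continuum ∕ ℝ⁴ ∕ OS.  TWO `def`s, no `instance`, no `notation`, no `sorry`.

References: [6] Thm. 4 p. 88, Prop. 6 (1.130)–(1.138) p. 99, p. 98, (1.7)–(1.9) p. 77, (1.29) p. 81; [15] (144) p. 300, (147)–(153) p. 301; [III] p. 255, (2.13) p. 256; [I] (0.1) p. 251,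
(0.3)–(0.4) pp. 252–253.
-/

set_option autoImplicit false

noncomputable section

open scoped BigOperators Matrix.Norms.L2Operator

namespace Summit.QuantumFields.YangMills.BalabanUVNodes.N07Thm4RecMemberOfCrown

open Literature.MathematicalPhysics.QuantumFieldTheory.Balaban1983to89
open Literature.MathematicalPhysics.QuantumFieldTheory.Balaban1983to89.Node00
open Literature.MathematicalPhysics.QuantumFieldTheory.Balaban1983to89.B12RegularSpaces111 (gaugeU expI grad)
open B15Eq112TorusCover (cover)
open B14DomainGeom (Pt Within)
open B8Eq131Cubes (box cube tcube tLo tHi)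
open B8Eq131CubesRec (boxZ cubeZ tcubeZ bLoZ bHiZ)
open B6SectADomainsV1 (Domains)
open B6SectAOperatorsV1 (RE dsE)
open B7Prop1Explicit (e gaugeAct)
open B7Prop1Local (AgreeOn)
open B7Prop2SpecialUnitary (specialUnitaryUnits)
open BlockAveragingZd (avgIterZ ctrShift)
open B8Ineq132 (covDerivFwd InAk)
open B8Eq140Level (SideTouches)
open B8Eq138LandauZd (logCfg covLap)
open B8Eq138LandauZdRec (IsLandau138WZ)
open B8Eq119TwistedAxialRec (Restr129Z)
open B7SectEFLinearisationRec (logCovIterZ)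
open B8Eq184Proof (cfgExp)
open B8ScaledSupNorm (msup bondNorm)
open B8Eq146AExpansion (plaqCovDeriv iEta)
open B8Eq143PlaqExpansion (pdiv)
open MatrixLog (mlog)
open Literature.MathematicalPhysics.QuantumFieldTheory.BalabanImbrieJaffe1984to88.BIJ85AxialPropagator411 (BondSpace)
open T4Continuum (T4Family)

variable (F : T4Family) (N : ℕ) [NeZero N]

/-! ## §1  The displayed premise (a): R6's crown AT THE PRINT DATUM -/

/-- **`DatumCrownAt` — [6] PROPOSITION 6 ∕ [15] (152)–(153) FOR THE RECORD STRUCTURE AT THE PRINT DATUM OF EVERY GRID CUBE** (the R6 crown — dag-n05-e's re-key of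
`GaugedBoundB8DZ` — specialised to `c := propCubePZ (F.P K) j hj Mc ρ hρ idx` over the constant ambient family «`Ω′ ≡ □̃ᶻ`», `G := SU(N)`, and read at ONE tolerance
`0 < α ≤ α₁` with radius `Cr·α`): for every approximation `K`, every `SU(N)` field `U` on the level-`0` torus, every level `j ≥ 1` and grid index `idx`, if the top-anchored lift
`x ↦ U(π(x + c_j·𝟙))` lies in `A_j({□̃ᶻ}, α)` then there is a gauge `u` with the twelve clauses of `GaugedBoundB8DZ` at radius `Cr·α`, `u` and `w = v⁻¹u` `SU(N)`-valued
(g10 FILE-11's hypothesis `hP6`, quantified).  A displayed premise, NEVER asserted (N05-REC's R6; print-licensed [I] pp. 253–254 for the (0.4) structure).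
[cite: Balaban1985RegularSpaces, Prop. 6 (1.135)–(1.138) p.99, p.98, (1.29) p.81; Balaban1985Variational, (152)–(153) p.301; Balaban1987RG1, (0.4) p.253] -/
def DatumCrownAt (Mc ρ : ℕ) (hρ : F.L ≤ ρ) (Cr α₁ : ℝ) : Prop :=
  ∀ (K : ℕ) (U : GaugeField (F.P K) 0 (SU N)) (j : ℕ) (hj : 1 ≤ j) (idx : Pt (F.P K).d) (α : ℝ), 0 < α → α ≤ α₁ →
    letI : CStarAlgebra (MatA N) := {};
    InAk (F.P K).L j ((F.P K).eta j) α (fun _ => tcubeZ (F.P K).L (cornerP (F.P K) Mc ρ idx) (sideP (F.P K) Mc ρ) ρ j)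
        (fun x μ => ιSU N (U ⟨cover (F.P K) (x + fun _ => (ctrShift (F.P K).L j : ℤ)), μ⟩)) →
    ∃ u : B7Prop1Explicit.Site (F.P K).d → (MatA N)ˣ, (∀ x, u x ∈ specialUnitaryUnits (Fin N)) ∧ (∀ x, x ∉ (propCubePZ (F.P K) j hj Mc ρ hρ idx).sq 0 → u x = 1) ∧
      Restr129Z (F.P K).L j (propCubePZ (F.P K) j hj Mc ρ hρ idx).lamS (1 : B7Prop1Explicit.Site (F.P K).d → Fin (F.P K).d → (MatA N)ˣ) u ∧
      IsLandau138WZ (F.P K).L j ((F.P K).eta j) ((propCubePZ (F.P K) j hj Mc ρ hρ idx).sq 0) (propCubePZ (F.P K) j hj Mc ρ hρ idx).lamS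
        (1 : B7Prop1Explicit.Site (F.P K).d → Fin (F.P K).d → (MatA N)ˣ)
        ((propCubePZ (F.P K) j hj Mc ρ hρ idx).fixed (fun x μ => ιSU N (U ⟨cover (F.P K) (x + fun _ => (ctrShift (F.P K).L j : ℤ)), μ⟩)) u) ∧
      (∀ j', j' ≤ j → ∀ b ∈ {b : B7Prop1Explicit.Site (F.P K).d × Fin (F.P K).d | SideTouches ((propCubePZ (F.P K) j hj Mc ρ hρ idx).sq j') b.1 b.2},
        (propCubePZ (F.P K) j hj Mc ρ hρ idx).fixed (fun x μ => ιSU N (U ⟨cover (F.P K) (x + fun _ => (ctrShift (F.P K).L j : ℤ)), μ⟩)) u b.1 b.2 =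
            cfgExp ((F.P K).eta j) (logCfg ((F.P K).eta j) ((propCubePZ (F.P K) j hj Mc ρ hρ idx).fixed
              (fun x μ => ιSU N (U ⟨cover (F.P K) (x + fun _ => (ctrShift (F.P K).L j : ℤ)), μ⟩)) u)) b.1 b.2 ∧
          IsSelfAdjoint (logCfg ((F.P K).eta j) ((propCubePZ (F.P K) j hj Mc ρ hρ idx).fixed
              (fun x μ => ιSU N (U ⟨cover (F.P K) (x + fun _ => (ctrShift (F.P K).L j : ℤ)), μ⟩)) u) b.1 b.2) ∧
          ‖logCfg ((F.P K).eta j) ((propCubePZ (F.P K) j hj Mc ρ hρ idx).fixed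
              (fun x μ => ιSU N (U ⟨cover (F.P K) (x + fun _ => (ctrShift (F.P K).L j : ℤ)), μ⟩)) u) b.1 b.2‖ ≤
            (Cr * α) * (((F.P K).L : ℝ) ^ j' * (F.P K).eta j)⁻¹) ∧
      (∀ x, (((propCubePZ (F.P K) j hj Mc ρ hρ idx).vfix (fun x μ => ιSU N (U ⟨cover (F.P K) (x + fun _ => (ctrShift (F.P K).L j : ℤ)), μ⟩)))⁻¹ * u) x ∈
        specialUnitaryUnits (Fin N)) ∧
      AgreeOn (B8Ineq130Rec.tlo (F.P K).L (tLo (cornerP (F.P K) Mc ρ idx) ρ) j) (B8Ineq130Rec.thi (F.P K).L (tHi (cornerP (F.P K) Mc ρ idx) (sideP (F.P K) Mc ρ) ρ) j)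
        (gaugeAct (((propCubePZ (F.P K) j hj Mc ρ hρ idx).vfix (fun x μ => ιSU N (U ⟨cover (F.P K) (x + fun _ => (ctrShift (F.P K).L j : ℤ)), μ⟩)))⁻¹ * u)⁻¹
          (fun x μ => ιSU N (U ⟨cover (F.P K) (x + fun _ => (ctrShift (F.P K).L j : ℤ)), μ⟩)))
        ((propCubePZ (F.P K) j hj Mc ρ hρ idx).fixed (fun x μ => ιSU N (U ⟨cover (F.P K) (x + fun _ => (ctrShift (F.P K).L j : ℤ)), μ⟩)) u) ∧
      msup (F.P K).L j ((F.P K).eta j) (-(2 : ℝ))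
          (fun j' (q : Fin (F.P K).d × Fin (F.P K).d × B7Prop1Explicit.Site (F.P K).d) => SideTouches ((propCubePZ (F.P K) j hj Mc ρ hρ idx).sq j') q.2.2 q.2.1)
          (fun q => covDerivFwd ((F.P K).eta j) (1 : B7Prop1Explicit.Site (F.P K).d → Fin (F.P K).d → (MatA N)ˣ) q.1
            (fun z => (propCubePZ (F.P K) j hj Mc ρ hρ idx).expo ((F.P K).eta j)
              (fun x μ => ιSU N (U ⟨cover (F.P K) (x + fun _ => (ctrShift (F.P K).L j : ℤ)), μ⟩)) u z q.2.1) q.2.2) ≤ Cr * α ∧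
      bondNorm (F.P K).L j ((F.P K).eta j) (-(3 : ℝ)) (propCubePZ (F.P K) j hj Mc ρ hρ idx).sq
          (fun x μ => pdiv ((F.P K).eta j) (1 : B7Prop1Explicit.Site (F.P K).d → Fin (F.P K).d → (MatA N)ˣ)
            (plaqCovDeriv ((F.P K).eta j) (1 : B7Prop1Explicit.Site (F.P K).d → Fin (F.P K).d → (MatA N)ˣ)
              ((propCubePZ (F.P K) j hj Mc ρ hρ idx).expo ((F.P K).eta j)
                (fun x μ => ιSU N (U ⟨cover (F.P K) (x + fun _ => (ctrShift (F.P K).L j : ℤ)), μ⟩)) u)) μ x) ≤ Cr * α ∧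
      bondNorm (F.P K).L j ((F.P K).eta j) (-(3 : ℝ)) (propCubePZ (F.P K) j hj Mc ρ hρ idx).sq
          (fun x μ => covLap ((F.P K).eta j) (1 : B7Prop1Explicit.Site (F.P K).d → Fin (F.P K).d → (MatA N)ˣ)
            (fun z => (propCubePZ (F.P K) j hj Mc ρ hρ idx).expo ((F.P K).eta j)
              (fun x μ => ιSU N (U ⟨cover (F.P K) (x + fun _ => (ctrShift (F.P K).L j : ℤ)), μ⟩)) u z μ) x) ≤ Cr * α ∧
      (∀ (x : B7Prop1Explicit.Site (F.P K).d) (μ : Fin (F.P K).d),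
        bLoZ (F.P K).L (cornerP (F.P K) Mc ρ idx) 0 0 ≤ x → x + e μ ≤ bHiZ (F.P K).L (cornerP (F.P K) Mc ρ idx) (sideP (F.P K) Mc ρ) 0 0 →
        (propCubePZ (F.P K) j hj Mc ρ hρ idx).inTop x → (propCubePZ (F.P K) j hj Mc ρ hρ idx).inTop (x + e μ) →
        logCovIterZ (F.P K).L (1 : B7Prop1Explicit.Site (F.P K).d → Fin (F.P K).d → (MatA N)ˣ)
            (iEta ((F.P K).eta j) ((propCubePZ (F.P K) j hj Mc ρ hρ idx).expo ((F.P K).eta j)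
              (fun x μ => ιSU N (U ⟨cover (F.P K) (x + fun _ => (ctrShift (F.P K).L j : ℤ)), μ⟩)) u)) j x μ =
          mlog ((avgIterZ (F.P K).L ((propCubePZ (F.P K) j hj Mc ρ hρ idx).axial
            (fun x μ => ιSU N (U ⟨cover (F.P K) (x + fun _ => (ctrShift (F.P K).L j : ℤ)), μ⟩))) j x μ : (MatA N)ˣ) : MatA N))

/-! ## §2  The conclusion shape: `HThm4RecDbar`'s rows 1–8 + the door's member rows -/

/-- **`HThm4RecMember` — dag-n07-e's `HThm4RecDbar F N Mc ρ κ a₀` (MODULE 88″ :80–111) WITH ITS NINTH ROW REPLACED BY THE DOOR's MEMBER ROWS**: the same binders (separated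
run, collar floor `(11·4 + 4ρ + Mc + 3)·L ≤ M₁`, no-wrap bound `Mc + 11·4 + 6ρ ≤ sitesPerDir k`, tolerances `0 < ε_n ≤ a₀`, `ε_n ≤ 2ε_{n+1}`, `SU(N)` field in the (1.7)∕(1.9)
class on the record regions, level `1 ≤ j ≤ k`, datum `idx` whose print box meets `Ω_j` within `3`), the same conclusion rows 1–8 BYTE FOR BYTE (gauge identity on the box and on
`□₀`, the STRICT (152)-letters `< κ·ε_j·L^{j−j′}` ∕ `< κ·ε_j`, the two co-differential rows, the (153) rows `R(D″) η⁻¹ (Re∕Im (φ∘A)) = 0`), and — in place of `NrmDbarWideOfRecord … u A`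
— `∃ um`, (iv′) `A(π(x + c_j·𝟙), μ) = logCfg η_j (U₁) x μ` on `□̃ᶻ`, (v) `ιSU (u (π(x + c_j·𝟙))) = (um x)⁻¹·v(x)` on `□₀ᶻ`, (vi) `um ∈ SU(N)`, `um = 1` off `□₀ᶻ`, (1.29)
`Restr129Z L j Λ′ 1 um`, (vii) (1.137) `Q_j(ηA) = log Ū₀′ʲ` on the bonds of `□^{(j)}` (the member rows of g10 FILE-10∕11, datum `propCubePZ (F.P K) j hj Mc ρ hρ idx`).
A displayed conclusion SHAPE (what the door yields); the step to `HThm4RecDbar` is obligation (e). [cite: Balaban1985RegularSpaces, Thm. 4 p.88, Prop. 6 (1.130)–(1.138) p.99, (1.29) p.81; Balaban1985Variational, (147)–(153) p.301; Balaban1987RG1, (0.4) p.253] -/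
def HThm4RecMember (Mc ρ : ℕ) (hρ : F.L ≤ ρ) (κ a₀ : ℝ) : Prop :=
  0 < κ → ∀ (ν : Stage7Numerics) (M : ℕ) (g : ℕ → ℝ) (K k : ℕ) (s : SeqOfRecord F ν M g K k), Sect2.SeqSeparated ν.M₁ s → 0 < ν.M₁ →
    (11 * 4 + 4 * ρ + Mc + 3) * F.L ≤ ν.M₁ → Mc + 11 * 4 + 6 * ρ ≤ (F.P K).sitesPerDir k → 1 ≤ k →
    ∀ (ε : ℕ → ℝ), (∀ n, n ≤ k → 0 < ε n ∧ ε n ≤ a₀) → (∀ n, n < k → ε n ≤ 2 * ε (n + 1)) →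
    ∀ U : GaugeField (F.P K) 0 (SU N),
    (∀ n, n ≤ k → PlaqSmallOn (Sect2.omegaPlaqsTop s.Ω (suppDomOfRecord F ν K s.Ω) n) (ε n * (F.P K).eta n ^ 2) U) →
    (∀ n, n ≤ k → Sect2.CoDivSmallOn (Sect2.omegaBondsTop s.Ω (suppDomOfRecord F ν K s.Ω) n) (ε n * (F.P K).eta n ^ 3) U) →
    ∀ (j : ℕ) (hk : j ≤ (F.P K).m + (F.P K).K) (hj : 1 ≤ j), j ≤ k → ∀ (idx : Pt (F.P K).d),
    (∃ x ∈ box (F.P K).L (cornerP (F.P K) Mc ρ idx) (sideP (F.P K) Mc ρ) j, ∃ y : Pt (F.P K).d, cover (F.P K) y ∈ s.Ω j ∧ Within ((3 : ℕ) : ℤ) x y) →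
    letI : CStarAlgebra (MatA N) := {};
    ∃ (u : GaugeTransf (F.P K) 0 (SU N)) (A : PBond (F.P K) 0 → MatA N),
      (∀ b ∈ (Sect2.regionOfSet (F.P K) (cover (F.P K) '' box (F.P K).L (cornerP (F.P K) Mc ρ idx) (sideP (F.P K) Mc ρ) j)).bonds,
        gaugeU (fun x => ιSU N (u x)) (fun b' => ιSU N (U b')) b = expI ((F.P K).eta j) (A b)) ∧
      (∀ b ∈ (Sect2.regionOfSet (F.P K) (cover (F.P K) '' cube (F.P K).L (cornerP (F.P K) Mc ρ idx) (sideP (F.P K) Mc ρ) ρ j 0)).bonds,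
        gaugeU (fun x => ιSU N (u x)) (fun b' => ιSU N (U b')) b = expI ((F.P K).eta j) (A b)) ∧
      (∀ j', j' ≤ j →
        ∀ b ∈ (Sect2.regionOfSet (F.P K) (cover (F.P K) '' cube (F.P K).L (cornerP (F.P K) Mc ρ idx) (sideP (F.P K) Mc ρ) ρ j j')).bonds,
          ‖A b‖ < κ * ε j * ((F.P K).L : ℝ) ^ (j - j')) ∧
      (∀ b ∈ (Sect2.regionOfSet (F.P K) (cover (F.P K) '' box (F.P K).L (cornerP (F.P K) Mc ρ idx) (sideP (F.P K) Mc ρ) j)).bonds,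
        ‖A b‖ < κ * ε j) ∧
      (∀ q ∈ (Sect2.regionOfSet (F.P K) (cover (F.P K) '' box (F.P K).L (cornerP (F.P K) Mc ρ idx) (sideP (F.P K) Mc ρ) j)).dpairs,
        ‖grad ((F.P K).eta j) q.2.1 (fun y => A ⟨y, q.2.2⟩) q.1‖ < κ * ε j) ∧
      (∀ b ∈ Sect2.bondsDeep (cover (F.P K) '' box (F.P K).L (cornerP (F.P K) Mc ρ idx) (sideP (F.P K) Mc ρ) j),
        ‖Sect2.codiffCurlA ((F.P K).eta j) A b.src b.dir‖ < κ * ε j) ∧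
      (∀ b ∈ Sect2.bondsDeep (cover (F.P K) '' box (F.P K).L (cornerP (F.P K) Mc ρ idx) (sideP (F.P K) Mc ρ) j),
        ‖∑ ν' : Fin (F.P K).d, (((F.P K).eta j : ℝ) : ℂ)⁻¹ •
            (grad ((F.P K).eta j) ν' (fun y => A ⟨y, b.dir⟩) (b.src.unshift ν') - grad ((F.P K).eta j) ν' (fun y => A ⟨y, b.dir⟩) b.src)‖ < κ * ε j) ∧
      (∀ φ : MatA N →L[ℂ] ℂ,
        RE (domainsMeet (cubeDomains (F.P K) (cornerP (F.P K) Mc ρ idx) (sideP (F.P K) Mc ρ) ρ j hk) (domainsOfSeq s.Ω j hk)) ((F.P K).eta j)⁻¹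
            (dsE ((F.P K).eta j)⁻¹ (WithLp.toLp 2 fun b => (φ (A b)).re : BondSpace (F.P K))) = 0 ∧
        RE (domainsMeet (cubeDomains (F.P K) (cornerP (F.P K) Mc ρ idx) (sideP (F.P K) Mc ρ) ρ j hk) (domainsOfSeq s.Ω j hk)) ((F.P K).eta j)⁻¹
            (dsE ((F.P K).eta j)⁻¹ (WithLp.toLp 2 fun b => (φ (A b)).im : BondSpace (F.P K))) = 0) ∧
      ∃ um : B7Prop1Explicit.Site (F.P K).d → (MatA N)ˣ,
      (∀ x, x ∈ tcubeZ (F.P K).L (cornerP (F.P K) Mc ρ idx) (sideP (F.P K) Mc ρ) ρ j → ∀ μ,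
          A ⟨cover (F.P K) (x + fun _ => (ctrShift (F.P K).L j : ℤ)), μ⟩ =
            logCfg ((F.P K).eta j) ((propCubePZ (F.P K) j hj Mc ρ hρ idx).fixed
              (fun x μ => ιSU N (U ⟨cover (F.P K) (x + fun _ => (ctrShift (F.P K).L j : ℤ)), μ⟩)) um) x μ) ∧
      (∀ x, x ∈ (propCubePZ (F.P K) j hj Mc ρ hρ idx).sq 0 →
          ιSU N (u (cover (F.P K) (x + fun _ => (ctrShift (F.P K).L j : ℤ)))) =
            (um x)⁻¹ * (propCubePZ (F.P K) j hj Mc ρ hρ idx).vfix (fun x μ => ιSU N (U ⟨cover (F.P K) (x + fun _ => (ctrShift (F.P K).L j : ℤ)), μ⟩)) x) ∧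
      (∀ x, um x ∈ specialUnitaryUnits (Fin N)) ∧ (∀ x, x ∉ (propCubePZ (F.P K) j hj Mc ρ hρ idx).sq 0 → um x = 1) ∧
      Restr129Z (F.P K).L j (propCubePZ (F.P K) j hj Mc ρ hρ idx).lamS (1 : B7Prop1Explicit.Site (F.P K).d → Fin (F.P K).d → (MatA N)ˣ) um ∧
      (∀ (x : B7Prop1Explicit.Site (F.P K).d) (μ : Fin (F.P K).d),
        bLoZ (F.P K).L (cornerP (F.P K) Mc ρ idx) 0 0 ≤ x → x + e μ ≤ bHiZ (F.P K).L (cornerP (F.P K) Mc ρ idx) (sideP (F.P K) Mc ρ) 0 0 →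
        (propCubePZ (F.P K) j hj Mc ρ hρ idx).inTop x → (propCubePZ (F.P K) j hj Mc ρ hρ idx).inTop (x + e μ) →
        logCovIterZ (F.P K).L (1 : B7Prop1Explicit.Site (F.P K).d → Fin (F.P K).d → (MatA N)ˣ)
            (iEta ((F.P K).eta j) ((propCubePZ (F.P K) j hj Mc ρ hρ idx).expo ((F.P K).eta j)
              (fun x μ => ιSU N (U ⟨cover (F.P K) (x + fun _ => (ctrShift (F.P K).L j : ℤ)), μ⟩)) um)) j x μ =
          mlog ((avgIterZ (F.P K).L ((propCubePZ (F.P K) j hj Mc ρ hρ idx).axial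
            (fun x μ => ιSU N (U ⟨cover (F.P K) (x + fun _ => (ctrShift (F.P K).L j : ℤ)), μ⟩))) j x μ : (MatA N)ˣ) : MatA N))

/-! ## §0  Arithmetic ∕ bookkeeping -/

variable {F N}

omit [NeZero N] in
/-- `sitesPerDir` is antitone in the level: `sitesPerDir k ≤ sitesPerDir j` for `j ≤ k` (`sitesPerDir j = 2·L^{m+K−j}`). [cite: Balaban1987RG1, (1.1) p.260 (bookkeeping)] -/
theorem sitesPerDir_anti (P : Params) {j k : ℕ} (hjk : j ≤ k) : P.sitesPerDir k ≤ P.sitesPerDir j := by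
  unfold Params.sitesPerDir
  exact Nat.mul_le_mul_left _ (Nat.pow_le_pow_right P.L_pos (by omega))

omit [NeZero N] in
/-- `(L^{j′}·η_j)⁻¹ = L^{j−j′}` for `j′ ≤ j` (`η_j = L^{−j}`). [cite: Balaban1987RG1, (1.1) p.260 (bookkeeping)] -/
theorem pow_mul_eta_inv_eq (P : Params) {j j' : ℕ} (h : j' ≤ j) : ((P.L : ℝ) ^ j' * P.eta j)⁻¹ = (P.L : ℝ) ^ (j - j') := by
  have hL : (P.L : ℝ) ≠ 0 := by exact_mod_cast P.L_pos.ne'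
  rw [B3GkZeroTorusRescaled.eta_eq_inv_pow, mul_inv, inv_inv, pow_sub₀ _ hL h]
  exact mul_comm _ _

omit [NeZero N] in
/-- The strict-row budget: `2·(Cr·L³·e′)·t < κ·e` whenever `e′ ≤ 2e`, `0 < e`, `0 ≤ t ≤ L³`, `4·Cr·L⁶ < κ` (`L ≥ 1`, `Cr ≥ 0`). [cite: Balaban1985Variational, (152) p.301 (bookkeeping)] -/
theorem two_mul_radius_mul_lt {L Cr κ e e' t : ℝ} (hL : 1 ≤ L) (hCr : 0 ≤ Cr) (hκ : 4 * Cr * L ^ 6 < κ) (he : 0 < e) (he' : e' ≤ 2 * e)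
    (ht : 0 ≤ t) (htL : t ≤ L ^ 3) : 2 * ((Cr * (L ^ 3 * e')) * t) < κ * e := by
  have hL3 : (0 : ℝ) ≤ L ^ 3 := by positivity
  have h1 : 2 * ((Cr * (L ^ 3 * e')) * t) ≤ 2 * ((Cr * (L ^ 3 * (2 * e))) * L ^ 3) := by gcongr
  have h2 : 2 * ((Cr * (L ^ 3 * (2 * e))) * L ^ 3) = 4 * Cr * L ^ 6 * e := by ring
  have h3 : 4 * Cr * L ^ 6 * e < κ * e := mul_lt_mul_of_pos_right hκ he
  linarith

/-! ## §2b  Monotonicity of the conclusion shape in its letters (dag-n07-e's `hThm4RecDbar_mono` at this text) -/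

/-- **MONOTONICITY OF `HThm4RecMember`**: for `0 < κ ≤ κ′` and `a₀′ ≤ a₀`, `HThm4RecMember F N Mc ρ hρ κ a₀ → HThm4RecMember F N Mc ρ hρ κ′ a₀′` — `κ` occurs only in the
strict (152)-rows `‖…‖ < κ·ε_j·(…)` (with `0 < ε_j`), `a₀` only in the tolerance ceiling `ε_n ≤ a₀`; the member rows do not read them.
[cite: Balaban1985RegularSpaces, Prop. 6 p.99; Balaban1985Variational, (152) p.301 (bookkeeping)] -/
theorem hThm4RecMember_mono {Mc ρ : ℕ} (hρ : F.L ≤ ρ) {κ κ' a₀ a₀' : ℝ} (h0 : 0 < κ) (hκ : κ ≤ κ') (ha : a₀' ≤ a₀)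
    (h : HThm4RecMember F N Mc ρ hρ κ a₀) : HThm4RecMember F N Mc ρ hρ κ' a₀' := by
  intro _ ν M g K k s hsep hM₁ hfl hnw hk ε hε hcomp U h17 h19 j hk' hj1 hjk idx hmeet
  have hε' : ∀ n, n ≤ k → 0 < ε n ∧ ε n ≤ a₀ := fun n hn => ⟨(hε n hn).1, (hε n hn).2.trans ha⟩
  obtain ⟨u, A, h1, hT1, hT2, h2, h3, h4, h5, h6, hmem⟩ :=
    h h0 ν M g K k s hsep hM₁ hfl hnw hk ε hε' hcomp U h17 h19 j hk' hj1 hjk idx hmeet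
  have hεj : 0 ≤ ε j := (hε j hjk).1.le
  have hκε : κ * ε j ≤ κ' * ε j := mul_le_mul_of_nonneg_right hκ hεj
  refine ⟨u, A, h1, hT1, ?_, ?_, ?_, ?_, ?_, h6, hmem⟩
  · intro j' hj' b hb
    exact (hT2 j' hj' b hb).trans_le (mul_le_mul_of_nonneg_right hκε (pow_nonneg (Nat.cast_nonneg _) _))
  · intro b hb; exact (h2 b hb).trans_le hκε
  · intro q hq; exact (h3 q hq).trans_le hκε
  · intro b hb; exact (h4 b hb).trans_le hκε
  · intro b hb; exact (h5 b hb).trans_le hκε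

/-! ## §3  ★★★ The knit modulo R6 at the datum -/

/-- ★★★ **`HThm4RecMember` ⟸ `DatumCrownAt`: THE R7 DOOR KNITTED INTO THE PREMISE OF RECORD's CURRENCY, MODULO R6 AT THE DATUM.**  For `F.L ≤ ρ`, `0 ≤ Cr`, the displayed
premise `DatumCrownAt F N Mc ρ hρ Cr α₁`, every `κ > 4·Cr·L⁶` and every ceiling `a₀` with `L³·a₀ ≤ α₁` and `4·N·Cr·L³·a₀ < 2π` (the profile's `0 < ε_n ≤ a₀` makes
`a₀ > 0` whenever the premise bites): `HThm4RecMember F N Mc ρ hρ κ a₀`.  Per datum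
`(j, idx)`: (b) the collar «`π(□̃) ⊆ Ω_{j−1}`» (`j ≥ 2`, dag-n07-e `Sect2.cover_image_Ω_cubeIdxP'_subset_of_within_mem_box`, floor `11·4 + 4ρ + Mc + 3 ≤ M₁`) ∕ «`⊆ Ω₀ =
hullD … M₁ 1 (Ω 1)`» (`j = 1`, `cover_mem_hullD_one_of_within`, reach `(44 + 4ρ)·L + (L·Mc − 1) + 3 ≤ M₁`) from the meeting witness; (c) `Set.InjOn π □̃` from `Mc + 44 + 6ρ ≤
sitesPerDir k ≤ sitesPerDir j` (g10 `injOn_cover_tcube_of_guard`); (d) `0 < L³·ε_{j−1} ≤ L³·a₀ ≤ α₁`, `4·N·Cr·L³·ε_{j−1} < 2π`; then g10 FILE-11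
`exists_datumGauge152_153_member_of_crownAt`; the box gauge identity from the `□₀` one (`box ⊆ □₀`, `regionOfSet_bonds_mono`); the strict rows by `two_mul_radius_mul_lt`
(`ε_{j−1} ≤ 2ε_j`, `(L^{j′}η_j)⁻¹ = L^{j−j′}`); the (153) rows at `D₂ := domainsOfSeq s.Ω j hk`; the member rows verbatim.
[cite: Balaban1985RegularSpaces, Thm. 4 p.88, Prop. 6 (1.130)–(1.138) p.99, p.98, (1.7)–(1.9) p.77, (1.29) p.81; Balaban1985Variational, (144) p.300, (147)–(153) p.301; Balaban1988Convergent, p.255, (2.13) p.256; Balaban1987RG1, (0.1) p.251, (0.3)–(0.4) pp.252–253] -/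
theorem hThm4RecMember_of_datumCrownAt {Mc ρ : ℕ} (hρ : F.L ≤ ρ) {Cr α₁ κ a₀ : ℝ} (hCr : 0 ≤ Cr) (hcrown : DatumCrownAt F N Mc ρ hρ Cr α₁)
    (hκ : 4 * Cr * (F.L : ℝ) ^ 6 < κ) (hα : (F.L : ℝ) ^ 3 * a₀ ≤ α₁) (hwin : 4 * ((N : ℝ) * (Cr * ((F.L : ℝ) ^ 3 * a₀))) < 2 * Real.pi) :
    HThm4RecMember F N Mc ρ hρ κ a₀ := by
  intro _ ν M g K k s hsep hM₁ hfl hnw hk1 ε hε hcomp U hP hD j hk hj1 hjk idx hmeet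
  letI : CStarAlgebra (MatA N) := {}
  have hL2 : 2 ≤ F.L := (F.P 0).hL.2
  have hL1 : (1 : ℝ) ≤ F.L := by exact_mod_cast (F.P 0).L_pos
  have hd : 2 ≤ (F.P K).d := by rw [T4Family.P_d]; norm_num
  have hρ' : (F.P K).L ≤ ρ := by rw [T4Family.P_L]; exact hρ
  -- (d) the tolerances at the datum
  have hεj1 : 0 < ε (j - 1) := (hε (j - 1) (by omega)).1
  have hεj1a : ε (j - 1) ≤ a₀ := (hε (j - 1) (by omega)).2
  have hεj : 0 < ε j := (hε j hjk).1
  have hε2 : ε (j - 1) ≤ 2 * ε j := by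
    have := hcomp (j - 1) (by omega)
    rwa [show j - 1 + 1 = j by omega] at this
  have hL3 : (0 : ℝ) < (F.L : ℝ) ^ 3 := by positivity
  have hαpos : 0 < ((F.P K).L : ℝ) ^ 3 * ε (j - 1) := by rw [T4Family.P_L]; exact mul_pos hL3 hεj1
  have hαle : ((F.P K).L : ℝ) ^ 3 * ε (j - 1) ≤ α₁ := by
    rw [T4Family.P_L]; exact (mul_le_mul_of_nonneg_left hεj1a hL3.le).trans hα
  have h4 : 4 * ((N : ℝ) * (Cr * (((F.P K).L : ℝ) ^ 3 * ε (j - 1)))) < 2 * Real.pi := by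
    rw [T4Family.P_L]
    refine lt_of_le_of_lt ?_ hwin
    have hN : (0 : ℝ) ≤ N := Nat.cast_nonneg N
    gcongr
  -- (c) the non-wrapping of `□̃` from the guard (`sitesPerDir` antitone)
  have hg : Mc + 11 * (F.P K).d + 6 * ρ ≤ (F.P K).sitesPerDir j := by
    rw [T4Family.P_d]
    exact hnw.trans (sitesPerDir_anti (F.P K) hjk)
  have hinj := injOn_cover_tcube_of_guard (P := F.P K) (a := idx) hk hg
  -- (b) the collar inclusion from the meeting witness
  obtain ⟨x, hx, y, hy, hxy⟩ := hmeet
  have hM₁1 : 1 ≤ ν.M₁ := hM₁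
  have hcollar : cover (F.P K) '' tcube (F.P K).L (cornerP (F.P K) Mc ρ idx) (sideP (F.P K) Mc ρ) ρ j ⊆
      (if j - 1 = 0 then suppDomOfRecord F ν K s.Ω else s.Ω (j - 1)) := by
    rcases Nat.lt_or_ge j 2 with hj2 | hj2
    · have hj1' : j = 1 := by omega
      subst hj1'
      rw [if_pos rfl, suppDomOfRecord_eq]
      rintro _ ⟨z, hz, rfl⟩
      have hz' : z ∈ (cubeIdxP' (F.P K) 1 le_rfl Mc ρ idx).Ω 0 := by rw [cubeIdxP'_Ω]; exact hz
      have hw := within_of_mem_Ω_cubeIdxP'_of_within_box (P := F.P K) le_rfl hx hxy hz'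
      refine cover_mem_hullD_one_of_within hM₁ hy (hw.mono ?_)
      rw [B14.Eq213MaximalDomains.side, pow_one, T4Family.P_d, T4Family.P_L]
      have hf : (((11 * 4 + 4 * ρ + Mc + 3) * F.L : ℕ) : ℤ) ≤ ν.M₁ := by exact_mod_cast hfl
      have hL1z : (1 : ℤ) ≤ F.L := by exact_mod_cast (F.P 0).L_pos
      push_cast at hf ⊢
      nlinarith
    · rw [if_neg (by omega)]
      have hfloor : 11 * (F.P K).d + 4 * ρ + Mc + 3 ≤ ν.M₁ := by
        rw [T4Family.P_d]
        exact le_trans (Nat.le_mul_of_pos_right _ (F.P 0).L_pos) hfl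
      have h := Sect2.cover_image_Ω_cubeIdxP'_subset_of_within_mem_box (P := F.P K) hM₁1 s hsep hfloor hj2 hjk hx hy hxy 0
      rwa [cubeIdxP'_Ω] at h
  -- (a) the crown at the datum, at the one tolerance `α_j = L³·ε_{j−1}`
  have hP6 := hcrown K U j hj1 idx (((F.P K).L : ℝ) ^ 3 * ε (j - 1)) hαpos hαle
  -- the door
  obtain ⟨u, A, um, h1, hlev, hbox, hgrad, hcurl, hsum, hRE, hmem⟩ :=
    exists_datumGauge152_153_member_of_crownAt (P := F.P K) (N := N) hd hj1 hk hρ' idx U hP hD (by omega) hεj1 hcollar hCr hP6 hinj h4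
  -- the strict-row budget at this datum
  have hLK : (1 : ℝ) ≤ ((F.P K).L : ℝ) := by rw [T4Family.P_L]; exact hL1
  have hκ' : 4 * Cr * ((F.P K).L : ℝ) ^ 6 < κ := by rw [T4Family.P_L]; exact hκ
  have hrow : ∀ t : ℝ, 0 ≤ t → t ≤ ((F.P K).L : ℝ) ^ 3 → 2 * ((Cr * (((F.P K).L : ℝ) ^ 3 * ε (j - 1))) * t) < κ * ε j :=
    fun t ht htL => two_mul_radius_mul_lt hLK hCr hκ' hεj hε2 ht htL
  have hL0 : (0 : ℝ) ≤ ((F.P K).L : ℝ) := Nat.cast_nonneg _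
  have hLpow : ∀ i : ℕ, i ≤ 3 → ((F.P K).L : ℝ) ^ i ≤ ((F.P K).L : ℝ) ^ 3 := fun i hi => pow_le_pow_right₀ hLK hi
  refine ⟨u, A, ?_, h1, ?_, ?_, ?_, ?_, ?_, fun φ => hRE (domainsOfSeq s.Ω j hk) φ, um, hmem⟩
  · -- row 1: the box lies in `□₀`
    intro b hb
    exact h1 b (Sect2.regionOfSet_bonds_mono (Set.image_mono (B8Eq131Cubes.box_subset_cube (Nat.zero_le j))) hb)
  · -- row 3: the level letters, `(L^{j′}η_j)⁻¹ = L^{j−j′}`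
    intro j' hj' b hb
    have h := hlev j' hj' b hb
    rw [pow_mul_eta_inv_eq (F.P K) hj'] at h
    refine h.trans_lt ?_
    have hpos : (0 : ℝ) < ((F.P K).L : ℝ) ^ (j - j') := by positivity
    have := hrow 1 zero_le_one (by simpa using hLpow 0 (by norm_num))
    rw [mul_one] at this
    calc 2 * (Cr * (((F.P K).L : ℝ) ^ 3 * ε (j - 1)) * ((F.P K).L : ℝ) ^ (j - j'))
        = 2 * (Cr * (((F.P K).L : ℝ) ^ 3 * ε (j - 1))) * ((F.P K).L : ℝ) ^ (j - j') := by ring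
      _ < κ * ε j * ((F.P K).L : ℝ) ^ (j - j') := mul_lt_mul_of_pos_right this hpos
  · -- row 4
    intro b hb
    exact (hbox b hb).trans_lt (hrow _ hL0 (by simpa using hLpow 1 (by norm_num)))
  · -- row 5
    intro q hq
    exact (hgrad q hq).trans_lt (hrow _ (by positivity) (hLpow 2 (by norm_num)))
  · -- row 6
    intro b hb
    exact (hcurl b hb).trans_lt (hrow _ (by positivity) le_rfl)
  · -- row 7
    intro b hb
    exact (hsum b hb).trans_lt (hrow _ (by positivity) le_rfl)

end Summit.QuantumFields.YangMills.BalabanUVNodes.N07Thm4RecMemberOfCrown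

end

/-! ## Axiom audit (gate whitelist: `propext`, `Classical.choice`, `Quot.sound`) -/
#print axioms Summit.QuantumFields.YangMills.BalabanUVNodes.N07Thm4RecMemberOfCrown.hThm4RecMember_of_datumCrownAt
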